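import Summits.HodgeConjecture.HodgeConjecture.Theorems.F0P6aStubEHECKE   -- ★ p853255 VERBATIM TWIN (LAST part; parts `…F0P6aStubEHECKESocket` p853042 → `…F0P6aStubEHECKEReaders` p853065 → `…F0P6aStubEHECKEOrganT` p853081 → `…F0P6aStubEHECKEOrganMP` p853092 → `…F0P6aStubEHECKEStageB` p853226 ride the import) of tree `Lines/F0_P6a_StubEHECKE.lean` aad6a91c0b7e0891 (1687 l.; namespace KEPT)
import HarnessLib
import HarnessLib.Audit.LibrarySuggestionsDenyListCruxes

/-! # F0_P6a_StubEHECKE — ED. 3 = SHIM (K6 P∕E column, LEAD F0P6-plan «M-142a» (B) ∕ «M-145d»; pen «L7» LA7-plan (g8; cut tables g7), RE-HOME TABLE v1.7; box LAref-P (g5) first ∕ LA-ref1 (g5) second)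

Every declaration of the previous edition (tree sha16 aad6a91c0b7e0891, 1687 l., sorry-free; 47 declarations, e.g. `StubEHECKE`, `OrganET`, `OrganMP`, `OrganEC`, `OrganER1`, `OrganER2`, `sheetPt`, `stub_ER1_of_MP`, `stub_EC_of_organs`, `stub_EHECKE_of_line`)
now lives, byte for byte (module docstring → `/- … -/` archaeology comment; closed `[cite:]` letters carry `(print: …)` locators — gate relocation rule) and under the SAME namespace
`Summit.HodgeConjecture.HodgeConjecture.Cruxes.HLiu418.F0P6aStubEHECKE`, in ★ `Theorems/F0P6aStubEHECKESocket.lean` (p853042) → ★ `Theorems/F0P6aStubEHECKEReaders.lean` (p853065) → ★ `Theorems/F0P6aStubEHECKEOrganT.lean` (p853081) → ★ `Theorems/F0P6aStubEHECKEOrganMP.lean` (p853092) → ★ `Theorems/F0P6aStubEHECKEStageB.lean` (p853226) → ★ `Theorems/F0P6aStubEHECKE.lean` (p853255); this module keeps its name so that its tree importers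
(`F0_P6a_EExports.lean` and any by-name reader under `open …F0P6aStubEHECKE`) resolve unchanged through the import above.
It declares nothing.  No declaration was cut in the ★ twin (verbatim re-home) ⇒ nothing to alias.  ONE budget line is NOT verbatim, by ruling: in ★ `Theorems/F0P6aStubEHECKEStageB.lean` (p853226)
`stub_ER1_of_MP` carries `set_option maxHeartbeats 480000 in` (tree row :1409 `400000`) under the ONE-DECL WAIVER req584 (21-frontier 2026-09-03, LEAD «M-149c»; measured 437 797 over the ★ imports —
cold `isDefEq` on abstracted `_proof_n` constants across the part seams, B-p04 (g51) census ∕ LA4-r01 #118), with the dated comment «-- heartbeats waiver 2026-09-03 req584, debt: return to ≤ 400000» and a BUDGET note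
in that decl՚s docstring; its statement and every proof byte are identical to the tree row (LA4-r01 `stmt_identity` 0).  DEBT-CURE (owner: E-column pen lineage, daylight ★-side proposal): re-prove it against a
`HeckeLinesRoofsAt` API lemma so goal and hypothesis share one proof term, then delete the waiver line.
ORDER NOTE: written on the LEAD՚s K6 shim-wave word together with the other shims of that wave; its `Lines` rev-closure by name (`F0_P6a_EExports`, `F0_P6a_StubGEN`, `F0_P6a_ModuliDatum`, `F0_D9opRoad2`, `F0_AlbCm`) re-makes in the same
request (NO-CROSS-IMPORT: no environment may hold a `Lines/` ORIGINAL of this module together with its ★ twin); an importer smoke that reads «environment already contains …»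
before that request is BUILT is this order note, not a defect.  Edition history stays in the line card and in git; future changes are ★-side proposals on the `Theorems/` files.
HC_CM is proved only modulo the 7 printed citations (2 remaining named inputs: hLiu418 = stmt-HodgeConjecture-24832, h413 = stmt-HodgeConjecture-24833) until rung 0 closes; count-neutral (0 `sorry`, 0 socket, 0 declarations). -/
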